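import Summits.CriticalPhenomena.PercolationContinuityZ3.Theorems.PercNearOneGluingNoHeavyLowerTailTwoPortExchangeTools
import HarnessLib

/-!
# `NoHeavyLowerTail` (stmt-CriticalPhenomena-4575) — two-port observers: the masses after opening the pairs at `o`

Support file (lemma factory #8 `prim-lf-8`, gen 9; `--supports stmt-CriticalPhenomena-4575`).  No definitions, no named facts,
no sorries.  `μ₀ = prodBernoulli w₀` on `Fin n` with every pair at `o` of weight `0` (`o` isolated almost surely), relays `A ∌ o`,
level `j`, `π(v) = {r ∈ A : v ↔ r}`, `L_v = {|π(v)| ≤ j}`, `H_v = {|π(v)| > j}`, `L_{ab} = {|π(a) ∪ π(b)| ≤ j}`.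
For the virtual configurations `ω + oa`, `ω + ob`, `ω + oa + ob` (the observer attached to `a`, to `b`, to both):
* `pair_light_q_heavy_iff`, `pair_heavy_q_light_iff` — after opening both pairs, "glued pair light & `q` heavy" (resp. heavy &
  light) holds iff it held before and `q ↮ a, b`;
* `real_preimage_one_attached`, `real_preimage_one_counts` — one pair: the attached observer's counts are the port's counts,
  all other counts unchanged;
* `real_preimage_two_light`, `real_preimage_two_heavy` — two pairs: the attached-light / attached-heavy masses are the
  glued-pair masses `μ₀({q↮a,b} ∩ L_{ab} ∩ H_q)`, `μ₀({q↮a,b} ∩ H_{ab} ∩ L_q)`;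
* `real_attached_eq_zero` — no pair: the observer is not attached.
-/

noncomputable section

namespace Summit.CriticalPhenomena.PercolationContinuityZ3.Theorems

open MeasureTheory Set Literature.Probability.LatticeModels Literature.Probability.Percolation
open scoped Classical BigOperators

variable {n : ℕ}

namespace TwoPortExchange

/-! ### The key dichotomy for `q` after opening both pairs -/

/-- After opening both pairs at an isolated non-relay `o`: "the pair `{a,b}` is light and `q` is heavy" holds iff it held before
AND `q` is joined to neither `a` nor `b` (otherwise `q` sits in the light glued cluster). [this work] -/
theorem pair_light_q_heavy_iff (A : Finset (Fin n)) {ω : BondConfig (Fin n)} {o a b q : Fin n} (j : ℕ)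
    (hN : ∀ v, v ≠ o → s(o, v) ∉ ω) (ho : o ∉ A) (hao : a ≠ o) (hbo : b ≠ o) (hqo : q ≠ o) :
    ((A.filter fun r => ω ∈ openConn a r ∨ ω ∈ openConn b r).card ≤ j ∧
        j < (A.filter fun r => insert s(o, a) (insert s(o, b) ω) ∈ openConn q r).card) ↔
      (ω ∈ (openConn a q : Set (BondConfig (Fin n)))ᶜ ∩ (openConn b q : Set (BondConfig (Fin n)))ᶜ ∧
        (A.filter fun r => ω ∈ openConn a r ∨ ω ∈ openConn b r).card ≤ j ∧
        j < (A.filter fun r => ω ∈ openConn q r).card) := by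
  constructor
  · rintro ⟨hl, hh⟩
    by_cases hq : (openGraph ω).Reachable q a ∨ (openGraph ω).Reachable q b
    · rw [filter_insert_two_of_reach A hN ho hao hbo hqo hq] at hh
      exact absurd hl (not_le.2 hh)
    · rw [not_or] at hq
      rw [filter_insert_two_of_not_reach A hN ho hao hbo hqo hq.1 hq.2] at hh
      exact ⟨⟨fun h => hq.1 (SimpleGraph.Reachable.symm h), fun h => hq.2 (SimpleGraph.Reachable.symm h)⟩, hl, hh⟩
  · rintro ⟨⟨hqa, hqb⟩, hl, hh⟩
    have hqa' : ¬ (openGraph ω).Reachable q a := fun h => hqa (SimpleGraph.Reachable.symm h)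
    have hqb' : ¬ (openGraph ω).Reachable q b := fun h => hqb (SimpleGraph.Reachable.symm h)
    rw [filter_insert_two_of_not_reach A hN ho hao hbo hqo hqa' hqb']
    exact ⟨hl, hh⟩

/-- Dual form: "the pair `{a,b}` is heavy and `q` is light" after opening both pairs iff before AND `q ↮ a, b`. [this work] -/
theorem pair_heavy_q_light_iff (A : Finset (Fin n)) {ω : BondConfig (Fin n)} {o a b q : Fin n} (j : ℕ)
    (hN : ∀ v, v ≠ o → s(o, v) ∉ ω) (ho : o ∉ A) (hao : a ≠ o) (hbo : b ≠ o) (hqo : q ≠ o) :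
    (j < (A.filter fun r => ω ∈ openConn a r ∨ ω ∈ openConn b r).card ∧
        (A.filter fun r => insert s(o, a) (insert s(o, b) ω) ∈ openConn q r).card ≤ j) ↔
      (ω ∈ (openConn a q : Set (BondConfig (Fin n)))ᶜ ∩ (openConn b q : Set (BondConfig (Fin n)))ᶜ ∧
        j < (A.filter fun r => ω ∈ openConn a r ∨ ω ∈ openConn b r).card ∧
        (A.filter fun r => ω ∈ openConn q r).card ≤ j) := by
  constructor
  · rintro ⟨hh, hl⟩
    by_cases hq : (openGraph ω).Reachable q a ∨ (openGraph ω).Reachable q b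
    · rw [filter_insert_two_of_reach A hN ho hao hbo hqo hq] at hl
      exact absurd hl (not_le.2 hh)
    · rw [not_or] at hq
      rw [filter_insert_two_of_not_reach A hN ho hao hbo hqo hq.1 hq.2] at hl
      exact ⟨⟨fun h => hq.1 (SimpleGraph.Reachable.symm h), fun h => hq.2 (SimpleGraph.Reachable.symm h)⟩, hh, hl⟩
  · rintro ⟨⟨hqa, hqb⟩, hh, hl⟩
    have hqa' : ¬ (openGraph ω).Reachable q a := fun h => hqa (SimpleGraph.Reachable.symm h)
    have hqb' : ¬ (openGraph ω).Reachable q b := fun h => hqb (SimpleGraph.Reachable.symm h)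
    rw [filter_insert_two_of_not_reach A hN ho hao hbo hqo hqa' hqb']
    exact ⟨hh, hl⟩

/-! ### The masses under `μ₀` after opening the pairs -/

/-- Transport of an identity on the isolated configurations: `S ∩ N = T ∩ N ⟹ μ₀(S) = μ₀(T)`. [folklore] -/
theorem real_eq_of_inter_isolated_eq (w₀ : Sym2 (Fin n) → unitInterval) (o : Fin n)
    (hw₀ : ∀ v, v ≠ o → w₀ s(o, v) = 0) {S T : Set (BondConfig (Fin n))}
    (h : S ∩ {ω | ∀ v, v ≠ o → s(o, v) ∉ ω} = T ∩ {ω | ∀ v, v ≠ o → s(o, v) ∉ ω}) :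
    (prodBernoulli w₀).real S = (prodBernoulli w₀).real T := by
  rw [real_eq_real_inter_isolated w₀ o hw₀ S, real_eq_real_inter_isolated w₀ o hw₀ T, h]

/-- Under `μ₀` the observer is isolated, so it is attached with probability `0`. [folklore] -/
theorem real_attached_eq_zero (w₀ : Sym2 (Fin n) → unitInterval) {o a b : Fin n} (hw₀ : ∀ v, v ≠ o → w₀ s(o, v) = 0)
    (hao : a ≠ o) (hbo : b ≠ o) (E : Set (BondConfig (Fin n))) :
    (prodBernoulli w₀).real ((((openConn o a : Set (BondConfig (Fin n))) ∪ (openConn o b : Set (BondConfig (Fin n)))) ∩ E)) = 0 := by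
  rw [real_eq_real_inter_isolated w₀ o hw₀]
  have : (((openConn o a : Set (BondConfig (Fin n))) ∪ (openConn o b : Set (BondConfig (Fin n)))) ∩ E) ∩
      {ω | ∀ v, v ≠ o → s(o, v) ∉ ω} = ∅ := by
    ext ω
    simp only [mem_inter_iff, mem_empty_iff_false, iff_false, not_and]
    rintro ⟨hU, -⟩ hN
    rcases hU with h | h
    · exact hao ((reachable_isolated_iff hN a).1 h)
    · exact hbo ((reachable_isolated_iff hN b).1 h)
  rw [this, measureReal_empty]

/-- One pair opened: the attached-light / attached-heavy events become the port's own light / heavy events.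
With `P, Q` the count predicates of the observer and of `q`:
`μ₀({ω | ω+oa ∈ ({o↔a}∪{o↔b}) ∩ {P |π(o)|} ∩ {Q |π(q)|}}) = μ₀({P |π(a)|} ∩ {Q |π(q)|})`. [this work] -/
theorem real_preimage_one_attached (w₀ : Sym2 (Fin n) → unitInterval) (A : Finset (Fin n)) {o a b q : Fin n}
    (hw₀ : ∀ v, v ≠ o → w₀ s(o, v) = 0) (ho : o ∉ A) (hao : a ≠ o) (hqo : q ≠ o) (P Q : ℕ → Prop) :
    (prodBernoulli w₀).real ((fun ω : BondConfig (Fin n) => insert s(o, a) ω) ⁻¹'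
        ((((openConn o a : Set (BondConfig (Fin n))) ∪ (openConn o b : Set (BondConfig (Fin n)))) ∩
          {ω | P (A.filter fun r => ω ∈ openConn o r).card}) ∩ {ω | Q (A.filter fun r => ω ∈ openConn q r).card})) =
      (prodBernoulli w₀).real ({ω | P (A.filter fun r => ω ∈ openConn a r).card} ∩
        {ω | Q (A.filter fun r => ω ∈ openConn q r).card}) := by
  refine real_eq_of_inter_isolated_eq w₀ o hw₀ ?_
  ext ω; constructor
  · rintro ⟨⟨⟨-, hP⟩, hQ⟩, hN⟩
    refine ⟨⟨?_, ?_⟩, hN⟩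
    · show P (A.filter fun r => ω ∈ openConn a r).card
      rw [← filter_insert_one_o A hN ho hao]; exact hP
    · show Q (A.filter fun r => ω ∈ openConn q r).card
      rw [← filter_insert_one_ne A (a := a) hN ho hqo]; exact hQ
  · rintro ⟨⟨hP, hQ⟩, hN⟩
    refine ⟨⟨⟨Or.inl ((reachable_insert_one_o_iff hN hao hao).2 (SimpleGraph.Reachable.refl a)), ?_⟩, ?_⟩, hN⟩
    · show P (A.filter fun r => insert s(o, a) ω ∈ openConn o r).card
      rw [filter_insert_one_o A hN ho hao]; exact hP
    · show Q (A.filter fun r => insert s(o, a) ω ∈ openConn q r).card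
      rw [filter_insert_one_ne A hN ho hqo]; exact hQ

/-- One pair `s(o,c)` opened: events about the counts of `x ≠ o` and `q ≠ o` are unchanged. [this work] -/
theorem real_preimage_one_counts (w₀ : Sym2 (Fin n) → unitInterval) (A : Finset (Fin n)) {o c x q : Fin n}
    (hw₀ : ∀ v, v ≠ o → w₀ s(o, v) = 0) (ho : o ∉ A) (hxo : x ≠ o) (hqo : q ≠ o) (P Q : ℕ → Prop) :
    (prodBernoulli w₀).real ((fun ω : BondConfig (Fin n) => insert s(o, c) ω) ⁻¹'
        ({ω | P (A.filter fun r => ω ∈ openConn x r).card} ∩ {ω | Q (A.filter fun r => ω ∈ openConn q r).card})) =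
      (prodBernoulli w₀).real ({ω | P (A.filter fun r => ω ∈ openConn x r).card} ∩
        {ω | Q (A.filter fun r => ω ∈ openConn q r).card}) := by
  refine real_eq_of_inter_isolated_eq w₀ o hw₀ ?_
  ext ω; constructor
  · rintro ⟨⟨hP, hQ⟩, hN⟩
    refine ⟨⟨?_, ?_⟩, hN⟩
    · show P (A.filter fun r => ω ∈ openConn x r).card
      rw [← filter_insert_one_ne A (a := c) hN ho hxo]; exact hP
    · show Q (A.filter fun r => ω ∈ openConn q r).card
      rw [← filter_insert_one_ne A (a := c) hN ho hqo]; exact hQ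
  · rintro ⟨⟨hP, hQ⟩, hN⟩
    refine ⟨⟨?_, ?_⟩, hN⟩
    · show P (A.filter fun r => insert s(o, c) ω ∈ openConn x r).card
      rw [filter_insert_one_ne A hN ho hxo]; exact hP
    · show Q (A.filter fun r => insert s(o, c) ω ∈ openConn q r).card
      rw [filter_insert_one_ne A hN ho hqo]; exact hQ

/-- Both pairs opened, light side: for `x ∈ {o, a, b}` (any vertex whose block becomes the glued pair),
`μ₀({ω | ω+oa+ob ∈ [U ∩] {|π(x)| ≤ j} ∩ H_q}) = μ₀({q↮a,b} ∩ L_{ab} ∩ H_q)`. [this work] -/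
theorem real_preimage_two_light (w₀ : Sym2 (Fin n) → unitInterval) (A : Finset (Fin n)) {o a b q x : Fin n} (j : ℕ)
    (hw₀ : ∀ v, v ≠ o → w₀ s(o, v) = 0) (ho : o ∉ A) (hao : a ≠ o) (hbo : b ≠ o) (hqo : q ≠ o)
    (hx : ∀ ω : BondConfig (Fin n), (∀ v, v ≠ o → s(o, v) ∉ ω) →
      (A.filter fun r => insert s(o, a) (insert s(o, b) ω) ∈ openConn x r) =
        A.filter fun r => ω ∈ openConn a r ∨ ω ∈ openConn b r)
    (U : Set (BondConfig (Fin n)))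
    (hU : ∀ ω : BondConfig (Fin n), (∀ v, v ≠ o → s(o, v) ∉ ω) → insert s(o, a) (insert s(o, b) ω) ∈ U) :
    (prodBernoulli w₀).real ((fun ω : BondConfig (Fin n) => insert s(o, a) (insert s(o, b) ω)) ⁻¹'
        ((U ∩ {ω | (A.filter fun r => ω ∈ openConn x r).card ≤ j}) ∩ {ω | j < (A.filter fun r => ω ∈ openConn q r).card})) =
      (prodBernoulli w₀).real (((openConn a q : Set (BondConfig (Fin n)))ᶜ ∩ (openConn b q : Set (BondConfig (Fin n)))ᶜ) ∩
        ({ω | (A.filter fun r => ω ∈ openConn a r ∨ ω ∈ openConn b r).card ≤ j} ∩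
          {ω | j < (A.filter fun r => ω ∈ openConn q r).card})) := by
  refine real_eq_of_inter_isolated_eq w₀ o hw₀ ?_
  ext ω; constructor
  · rintro ⟨⟨⟨-, hl⟩, hh⟩, hN⟩
    have hl' : (A.filter fun r => ω ∈ openConn a r ∨ ω ∈ openConn b r).card ≤ j := by
      rw [← hx ω hN]; exact hl
    obtain ⟨hD, hl2, hh2⟩ := (pair_light_q_heavy_iff A j hN ho hao hbo hqo).1 ⟨hl', hh⟩
    exact ⟨⟨hD, hl2, hh2⟩, hN⟩
  · rintro ⟨⟨hD, hl, hh⟩, hN⟩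
    obtain ⟨-, hh2⟩ := (pair_light_q_heavy_iff A j hN ho hao hbo hqo).2 ⟨hD, hl, hh⟩
    refine ⟨⟨⟨hU ω hN, ?_⟩, hh2⟩, hN⟩
    show (A.filter fun r => insert s(o, a) (insert s(o, b) ω) ∈ openConn x r).card ≤ j
    rw [hx ω hN]; exact hl

/-- Both pairs opened, heavy side: `μ₀({ω | ω+oa+ob ∈ [U ∩] {|π(x)| > j} ∩ L_q}) = μ₀({q↮a,b} ∩ H_{ab} ∩ L_q)`. [this work] -/
theorem real_preimage_two_heavy (w₀ : Sym2 (Fin n) → unitInterval) (A : Finset (Fin n)) {o a b q x : Fin n} (j : ℕ)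
    (hw₀ : ∀ v, v ≠ o → w₀ s(o, v) = 0) (ho : o ∉ A) (hao : a ≠ o) (hbo : b ≠ o) (hqo : q ≠ o)
    (hx : ∀ ω : BondConfig (Fin n), (∀ v, v ≠ o → s(o, v) ∉ ω) →
      (A.filter fun r => insert s(o, a) (insert s(o, b) ω) ∈ openConn x r) =
        A.filter fun r => ω ∈ openConn a r ∨ ω ∈ openConn b r)
    (U : Set (BondConfig (Fin n)))
    (hU : ∀ ω : BondConfig (Fin n), (∀ v, v ≠ o → s(o, v) ∉ ω) → insert s(o, a) (insert s(o, b) ω) ∈ U) :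
    (prodBernoulli w₀).real ((fun ω : BondConfig (Fin n) => insert s(o, a) (insert s(o, b) ω)) ⁻¹'
        ((U ∩ {ω | j < (A.filter fun r => ω ∈ openConn x r).card}) ∩ {ω | (A.filter fun r => ω ∈ openConn q r).card ≤ j})) =
      (prodBernoulli w₀).real (((openConn a q : Set (BondConfig (Fin n)))ᶜ ∩ (openConn b q : Set (BondConfig (Fin n)))ᶜ) ∩
        ({ω | j < (A.filter fun r => ω ∈ openConn a r ∨ ω ∈ openConn b r).card} ∩
          {ω | (A.filter fun r => ω ∈ openConn q r).card ≤ j})) := by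
  refine real_eq_of_inter_isolated_eq w₀ o hw₀ ?_
  ext ω; constructor
  · rintro ⟨⟨⟨-, hh⟩, hl⟩, hN⟩
    have hh' : j < (A.filter fun r => ω ∈ openConn a r ∨ ω ∈ openConn b r).card := by
      rw [← hx ω hN]; exact hh
    obtain ⟨hD, hh2, hl2⟩ := (pair_heavy_q_light_iff A j hN ho hao hbo hqo).1 ⟨hh', hl⟩
    exact ⟨⟨hD, hh2, hl2⟩, hN⟩
  · rintro ⟨⟨hD, hh, hl⟩, hN⟩
    obtain ⟨-, hl2⟩ := (pair_heavy_q_light_iff A j hN ho hao hbo hqo).2 ⟨hD, hh, hl⟩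
    refine ⟨⟨⟨hU ω hN, ?_⟩, hl2⟩, hN⟩
    show j < (A.filter fun r => insert s(o, a) (insert s(o, b) ω) ∈ openConn x r).card
    rw [hx ω hN]; exact hh

end TwoPortExchange

end Summit.CriticalPhenomena.PercolationContinuityZ3.Theorems

end
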